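import Summits.QuantumFields.YangMills.Theorems.SwapVirialDeficitZeroModeExactRealPart
import HarnessLib

/-!
# Zero-mode EXACT rung Z3, closed form: `Haar²{‖[q₁,q₂]‖ ≤ t} = (2/π)(arctan ρ − ρ/(1+ρ²)) + (t²/π)(π/2 − arctan ρ)`, `ρ = t/√(4−t²)`,
# and the exact inverse moment `E_Haar[‖Im q u‖⁻²] = E_Haar[(1 − re(q u)²)⁻¹] = 2`
# (free-hands support of crux ⟨stmt-QuantumFields-24197⟩ `SwapVirialDeficit.SwapGluedStiffness`; zero-mode exact rung Z2/Z3 of fcl-p3 g43's plan)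

From ✓`haar_pair_commBall_eq_lintegral` (`Haar² = ∫ min(1, t²/(4‖Im q a‖²)) dHaar(a)`) split at the saturation cap `‖Im q a‖² ≤ t²/4`:
* §20 the CAP MASS `Haar{‖Im q u‖² ≤ c} = (2/π)(arctan ρ − ρ/(1+ρ²))`, `ρ² = c/(1−c)` (both gnomonic hemispheres, ✓`lintegral_cap_cutoff`);
* §21 the TRUNCATED INVERSE MOMENT `∫_{‖Im q‖² > c} t²/(4‖Im q‖²) dHaar = (t²/π)(π/2 − arctan ρ)` (✓`integral_Ioi_inv_one_add_sq`);
* §22 ★★★ `haar_pair_commBall_closed_form` — the sum, an EXACT formula for every `0 ≤ t < 2` (at `t → 2⁻` it tends to `1`, at small `t` it is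
  `t²/2 − t³/(3π) + O(t⁵)`, refining ✓`abs_haar_pair_commBall_sub_le`);
* §23 ★★ `integral_haar_inv_sq_norm_im : ∫ (‖Im q u‖²)⁻¹ dHaar = 2` and ★★ `integral_haar_inv_one_sub_re_sq : ∫ (1 − re(q u)²)⁻¹ dHaar = 2`
  (Bochner; the memo's `v₂ = ¼·E[(1−re²)⁻¹]`).

HONEST LABEL: exact finite-dimensional Haar identities (plan-level zero-mode rung of a DRAFT line); NOT the fixed-`L` sharp law, NOT ⟨24197⟩; no rung /
summit statement is proved; the Yang–Mills mass gap is NOT proved; no summit is proved by a line.  Width seat ym-line-sfw-p2-w3 g62 (cell ym-idea-1,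
free hands; own crux ⟨22884⟩ blocked-on ⟨19935⟩), `--supports stmt-QuantumFields-24197`.  THEOREMS ONLY, standard axioms, 0 `sorry`.
References: [cite: Chatterjee2026YMHiggs, Lemma 5.1 / Cor. 5.2]; [folklore].
-/

set_option autoImplicit false

noncomputable section

open MeasureTheory Quaternion Set Real Filter
open scoped Quaternion ENNReal BigOperators Topology
open Literature.MathematicalPhysics.QuantumLattice
open Literature.MathematicalPhysics.QuantumFieldTheory (haarProbability)
open Literature.MathematicalPhysics.QuantumFieldTheory.Balaban1983to89.T4HaarSU2Translate (su2Quat_quatToSU2 measurable_su2Quat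
  continuous_su2Quat)
open Summit.QuantumFields.YangMills.Theorems.SwapTwistDeficit.ToronLog
open Summit.QuantumFields.YangMills.Theorems.ToronValleyVolume.NearlyCommutingCeiling (sq_norm_im_eq)

attribute [local instance] Literature.Analysis.FluidPDE.Tao2016.quatMeasurableSpace
  Literature.Analysis.FluidPDE.Tao2016.quatBorelSpace
  Literature.MathematicalPhysics.QuantumLattice.secondCountableTopology_su2

namespace Summit.QuantumFields.YangMills.Theorems.SwapVirialDeficit.ZeroModeExact

/-! ## §20 The cap mass `Haar{‖Im q u‖² ≤ c}` -/

/-- Continuity of `u ↦ ‖Im q u‖²`. [folklore] -/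
theorem continuous_sqNormIm : Continuous fun u : Matrix.specialUnitaryGroup (Fin 2) ℂ => ‖(su2Quat u).im‖ ^ 2 :=
  ((Quaternion.continuous_im.comp continuous_su2Quat).norm).pow 2

/-- ★ **CAP MASS**: `Haar{u | ‖Im q u‖² ≤ c} = (2/π)·(arctan ρ − ρ/(1+ρ²))` with `ρ = √(c/(1−c))`, for `0 ≤ c < 1`. [folklore] -/
theorem haar_sqNormIm_le_eq {c : ℝ} (hc : 0 ≤ c) (hc1 : c < 1) :
    haarProbability (Matrix.specialUnitaryGroup (Fin 2) ℂ) {u : Matrix.specialUnitaryGroup (Fin 2) ℂ | ‖(su2Quat u).im‖ ^ 2 ≤ c} =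
      ENNReal.ofReal (2 / Real.pi * (Real.arctan (Real.sqrt (c / (1 - c))) - Real.sqrt (c / (1 - c)) * (1 + c / (1 - c))⁻¹)) := by
  set T := {u : Matrix.specialUnitaryGroup (Fin 2) ℂ | ‖(su2Quat u).im‖ ^ 2 ≤ c} with hT
  set S : ℝ := c / (1 - c) with hSdef
  have h1c : 0 < 1 - c := by linarith
  have hS : 0 ≤ S := div_nonneg hc h1c.le
  have hTm : MeasurableSet T := measurableSet_le continuous_sqNormIm.measurable measurable_const
  have hmeas : Measurable (T.indicator (1 : Matrix.specialUnitaryGroup (Fin 2) ℂ → ℝ≥0∞)) := measurable_one.indicator hTm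
  rw [← lintegral_indicator_one hTm, lintegral_haarProbability_su2_gnomonic _ hmeas]
  -- both chart points are in the cap iff `|v|² ≤ S`
  have hmem : ∀ (v : Fin 3 → ℝ) (s : Bool), quatToSU2 (if s then gnomonicQuat v else -gnomonicQuat v) ∈ T ↔ ∑ i, v i ^ 2 ∈ Set.Iic S := by
    intro v s
    have hpos : 0 < 1 + ∑ i, v i ^ 2 := by positivity
    rw [hT, Set.mem_setOf_eq, sq_norm_im_proj_gnomonic, div_le_iff₀ hpos, Set.mem_Iic, hSdef, le_div_iff₀ h1c]
    constructor <;> intro h <;> nlinarith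
  have hpt : ∀ v : Fin 3 → ℝ, (T.indicator (1 : Matrix.specialUnitaryGroup (Fin 2) ℂ → ℝ≥0∞) (quatToSU2 (gnomonicQuat v)) +
      T.indicator (1 : Matrix.specialUnitaryGroup (Fin 2) ℂ → ℝ≥0∞) (quatToSU2 (-gnomonicQuat v))) * ENNReal.ofReal (((1 + ∑ i, v i ^ 2)⁻¹) ^ 2) =
      2 * (Set.Iic S).indicator (fun s : ℝ => ENNReal.ofReal (((1 + s)⁻¹) ^ 2)) (∑ i, v i ^ 2) := by
    intro v
    have hp := hmem v true
    have hm := hmem v false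
    simp only [↓reduceIte, Bool.false_eq_true] at hp hm
    by_cases hv : ∑ i, v i ^ 2 ∈ Set.Iic S
    · rw [indicator_of_mem (hp.2 hv), indicator_of_mem (hm.2 hv), indicator_of_mem hv, Pi.one_apply, Pi.one_apply]; ring
    · rw [indicator_of_notMem (fun h => hv (hp.1 h)), indicator_of_notMem (fun h => hv (hm.1 h)), indicator_of_notMem hv]; simp
  simp_rw [hpt]
  have hmI : Measurable ((Set.Iic S).indicator (fun s : ℝ => ENNReal.ofReal (((1 + s)⁻¹) ^ 2))) :=
    (ENNReal.measurable_ofReal.comp (by fun_prop)).indicator measurableSet_Iic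
  have hmI' : Measurable fun v : Fin 3 → ℝ => (Set.Iic S).indicator (fun s : ℝ => ENNReal.ofReal (((1 + s)⁻¹) ^ 2)) (∑ i, v i ^ 2) :=
    hmI.comp (by fun_prop)
  rw [lintegral_const_mul _ hmI',
    show (fun v : Fin 3 → ℝ => (Set.Iic S).indicator (fun s : ℝ => ENNReal.ofReal (((1 + s)⁻¹) ^ 2)) (∑ i, v i ^ 2)) =
      fun v => ((Set.Iic S).indicator (fun s : ℝ => ENNReal.ofReal (((1 + s)⁻¹) ^ 2))) (∑ i, v i ^ 2) from rfl,
    lintegral_chart_radial _ hmI, lintegral_cap_cutoff hS, show (2 : ℝ≥0∞) = ENNReal.ofReal 2 by simp]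
  -- nonnegativity of the cap integral value
  have hval : 0 ≤ (Real.arctan (Real.sqrt S) - Real.sqrt S * (1 + S)⁻¹) / 2 := by
    have h := integral_cap (Real.sqrt S)
    have hnn : 0 ≤ ∫ r in (0 : ℝ)..Real.sqrt S, r ^ 2 * ((1 + r ^ 2)⁻¹) ^ 2 :=
      intervalIntegral.integral_nonneg (Real.sqrt_nonneg S) fun r _ => by positivity
    rw [h, Real.sq_sqrt hS] at hnn
    exact hnn
  rw [← ENNReal.ofReal_mul (by positivity), ← ENNReal.ofReal_mul (by norm_num), ← ENNReal.ofReal_mul (by positivity)]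
  congr 1
  field_simp
  ring

/-! ## §21 The truncated inverse moment -/

/-- The complement of the chart ball: `∫_{|v|² > ρ²} |v|⁻²(1+|v|²)⁻¹ dv = 4π(π/2 − arctan ρ)` (`ρ ≥ 0`). [folklore] -/
theorem lintegral_chart_invSq_compl {ρ : ℝ} (hρ : 0 ≤ ρ) :
    ∫⁻ v : Fin 3 → ℝ, (Set.Ioi (ρ ^ 2)).indicator (fun s : ℝ => ENNReal.ofReal (s⁻¹ * (1 + s)⁻¹)) (∑ i, v i ^ 2) =
      ENNReal.ofReal (4 * Real.pi * (Real.pi / 2 - Real.arctan ρ)) := by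
  have hm : Measurable ((Set.Ioi (ρ ^ 2)).indicator (fun s : ℝ => ENNReal.ofReal (s⁻¹ * (1 + s)⁻¹))) :=
    (ENNReal.measurable_ofReal.comp (by fun_prop)).indicator measurableSet_Ioi
  rw [lintegral_chart_radial _ hm]
  have hpt : ∀ r ∈ Ioi (0 : ℝ), ENNReal.ofReal (r ^ 2) * (Set.Ioi (ρ ^ 2)).indicator (fun s : ℝ => ENNReal.ofReal (s⁻¹ * (1 + s)⁻¹)) (r ^ 2)
      = (Set.Ioi ρ).indicator (fun r : ℝ => ENNReal.ofReal ((1 + r ^ 2)⁻¹)) r := by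
    intro r hr
    have hr' : (0 : ℝ) < r := hr
    by_cases h : r ^ 2 ∈ Set.Ioi (ρ ^ 2)
    · have hrρ : ρ < r := by
        have : ρ ^ 2 < r ^ 2 := h
        nlinarith
      rw [indicator_of_mem h, indicator_of_mem (show r ∈ Ioi ρ from hrρ), ← ENNReal.ofReal_mul (sq_nonneg _)]
      congr 1; field_simp
    · have hrρ : ¬ ρ < r := fun h' => h (by
        show ρ ^ 2 < r ^ 2
        nlinarith)
      rw [indicator_of_notMem h, indicator_of_notMem (show r ∉ Ioi ρ from hrρ), mul_zero]
  rw [setLIntegral_congr_fun measurableSet_Ioi hpt, lintegral_indicator measurableSet_Ioi, Measure.restrict_restrict measurableSet_Ioi,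
    show Ioi ρ ∩ Ioi (0 : ℝ) = Ioi ρ from Set.inter_eq_left.2 (Set.Ioi_subset_Ioi hρ),
    ← ofReal_integral_eq_lintegral_ofReal integrable_inv_one_add_sq.integrableOn (Filter.Eventually.of_forall fun r => by positivity),
    integral_Ioi_inv_one_add_sq, ← ENNReal.ofReal_mul (by positivity)]

/-- ★ **TRUNCATED INVERSE MOMENT**: `∫ 𝟙{‖Im q a‖² > c}·t²/(4‖Im q a‖²) dHaar(a) = (t²/π)(π/2 − arctan √(c/(1−c)))` (`0 ≤ c < 1`). [folklore] -/
theorem lintegral_haar_profile_offCap {c : ℝ} (hc : 0 ≤ c) (hc1 : c < 1) (t : ℝ) :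
    ∫⁻ a, ({a : Matrix.specialUnitaryGroup (Fin 2) ℂ | c < ‖(su2Quat a).im‖ ^ 2}).indicator
        (fun a => ENNReal.ofReal (t ^ 2 / (4 * ‖(su2Quat a).im‖ ^ 2))) a ∂(haarProbability (Matrix.specialUnitaryGroup (Fin 2) ℂ)) =
      ENNReal.ofReal (t ^ 2 / Real.pi * (Real.pi / 2 - Real.arctan (Real.sqrt (c / (1 - c))))) := by
  set ρ : ℝ := Real.sqrt (c / (1 - c)) with hρdef
  have h1c : 0 < 1 - c := by linarith
  have hρ : 0 ≤ ρ := Real.sqrt_nonneg _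
  have hρ2 : ρ ^ 2 = c / (1 - c) := Real.sq_sqrt (div_nonneg hc h1c.le)
  have hSm : MeasurableSet {a : Matrix.specialUnitaryGroup (Fin 2) ℂ | c < ‖(su2Quat a).im‖ ^ 2} :=
    measurableSet_lt measurable_const continuous_sqNormIm.measurable
  have hF : Measurable (({a : Matrix.specialUnitaryGroup (Fin 2) ℂ | c < ‖(su2Quat a).im‖ ^ 2}).indicator
      (fun a => ENNReal.ofReal (t ^ 2 / (4 * ‖(su2Quat a).im‖ ^ 2)))) :=
    (ENNReal.measurable_ofReal.comp (measurable_const.div (continuous_sqNormIm.measurable.const_mul 4))).indicator hSm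
  rw [lintegral_haarProbability_su2_gnomonic _ hF]
  have hmem : ∀ (v : Fin 3 → ℝ) (s : Bool), quatToSU2 (if s then gnomonicQuat v else -gnomonicQuat v) ∈
      {a : Matrix.specialUnitaryGroup (Fin 2) ℂ | c < ‖(su2Quat a).im‖ ^ 2} ↔ ∑ i, v i ^ 2 ∈ Set.Ioi (ρ ^ 2) := by
    intro v s
    have hpos : 0 < 1 + ∑ i, v i ^ 2 := by positivity
    rw [Set.mem_setOf_eq, sq_norm_im_proj_gnomonic, lt_div_iff₀ hpos, Set.mem_Ioi, hρ2, div_lt_iff₀ h1c]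
    constructor <;> intro h <;> nlinarith
  have hpt : ∀ v : Fin 3 → ℝ, (({a : Matrix.specialUnitaryGroup (Fin 2) ℂ | c < ‖(su2Quat a).im‖ ^ 2}).indicator
      (fun a => ENNReal.ofReal (t ^ 2 / (4 * ‖(su2Quat a).im‖ ^ 2))) (quatToSU2 (gnomonicQuat v)) +
      ({a : Matrix.specialUnitaryGroup (Fin 2) ℂ | c < ‖(su2Quat a).im‖ ^ 2}).indicator
      (fun a => ENNReal.ofReal (t ^ 2 / (4 * ‖(su2Quat a).im‖ ^ 2))) (quatToSU2 (-gnomonicQuat v))) *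
      ENNReal.ofReal (((1 + ∑ i, v i ^ 2)⁻¹) ^ 2) =
      ENNReal.ofReal (t ^ 2 / 2) * (Set.Ioi (ρ ^ 2)).indicator (fun s : ℝ => ENNReal.ofReal (s⁻¹ * (1 + s)⁻¹)) (∑ i, v i ^ 2) := by
    intro v
    have hp := hmem v true
    have hm := hmem v false
    have hp' := profile_chart t v true
    have hm' := profile_chart t v false
    simp only [↓reduceIte, Bool.false_eq_true] at hp hm hp' hm'
    by_cases hv : ∑ i, v i ^ 2 ∈ Set.Ioi (ρ ^ 2)
    · rw [indicator_of_mem (hp.2 hv), indicator_of_mem (hm.2 hv), indicator_of_mem hv, add_mul,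
        ← ENNReal.ofReal_mul (by positivity), ← ENNReal.ofReal_mul (by positivity), hp', hm',
        ← ENNReal.ofReal_add (by positivity) (by positivity), ← ENNReal.ofReal_mul (by positivity)]
      congr 1; ring
    · rw [indicator_of_notMem (fun h => hv (hp.1 h)), indicator_of_notMem (fun h => hv (hm.1 h)), indicator_of_notMem hv]; simp
  have hmI : Measurable fun v : Fin 3 → ℝ => (Set.Ioi (ρ ^ 2)).indicator (fun s : ℝ => ENNReal.ofReal (s⁻¹ * (1 + s)⁻¹)) (∑ i, v i ^ 2) :=
    ((ENNReal.measurable_ofReal.comp (by fun_prop : Measurable fun s : ℝ => s⁻¹ * (1 + s)⁻¹)).indicator measurableSet_Ioi).comp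
      (by fun_prop)
  simp_rw [hpt]
  rw [lintegral_const_mul _ hmI, lintegral_chart_invSq_compl hρ, ← ENNReal.ofReal_mul (by positivity), ← ENNReal.ofReal_mul (by positivity)]
  congr 1; field_simp; ring

/-! ## §22 ★★★ The closed formula -/

/-- ★★★ **NEARLY COMMUTING PAIR, CLOSED FORM**: for `0 ≤ t < 2`, with `ρ = √((t²/4)/(1 − t²/4)) = t/√(4 − t²)`,
`Haar²{(u₁,u₂) | ‖q u₁·q u₂ − q u₂·q u₁‖ ≤ t} = (2/π)(arctan ρ − ρ/(1+ρ²)) + (t²/π)(π/2 − arctan ρ)`. [folklore] -/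
theorem haar_pair_commBall_closed_form {t : ℝ} (ht : 0 ≤ t) (ht2 : t < 2) :
    ((haarProbability (Matrix.specialUnitaryGroup (Fin 2) ℂ)).prod (haarProbability (Matrix.specialUnitaryGroup (Fin 2) ℂ))).real
        {p | ‖su2Quat p.1 * su2Quat p.2 - su2Quat p.2 * su2Quat p.1‖ ≤ t} =
      2 / Real.pi * (Real.arctan (Real.sqrt ((t ^ 2 / 4) / (1 - t ^ 2 / 4))) -
          Real.sqrt ((t ^ 2 / 4) / (1 - t ^ 2 / 4)) * (1 + (t ^ 2 / 4) / (1 - t ^ 2 / 4))⁻¹) +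
        t ^ 2 / Real.pi * (Real.pi / 2 - Real.arctan (Real.sqrt ((t ^ 2 / 4) / (1 - t ^ 2 / 4)))) := by
  set c : ℝ := t ^ 2 / 4 with hcdef
  have hc : 0 ≤ c := by positivity
  have hc1 : c < 1 := by rw [hcdef]; nlinarith
  have hae : ∀ᵐ a ∂(haarProbability (Matrix.specialUnitaryGroup (Fin 2) ℂ)), (su2Quat a).im ≠ 0 :=
    ae_iff.2 (by simpa using haar_im_eq_zero_null)
  -- split `min(1, X)` at the cap, almost everywhere
  have hsplit : ∀ᵐ a ∂(haarProbability (Matrix.specialUnitaryGroup (Fin 2) ℂ)),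
      ENNReal.ofReal (min 1 (t ^ 2 / (4 * ‖(su2Quat a).im‖ ^ 2))) =
        ({u : Matrix.specialUnitaryGroup (Fin 2) ℂ | ‖(su2Quat u).im‖ ^ 2 ≤ c}).indicator 1 a +
        ({a : Matrix.specialUnitaryGroup (Fin 2) ℂ | c < ‖(su2Quat a).im‖ ^ 2}).indicator
          (fun a => ENNReal.ofReal (t ^ 2 / (4 * ‖(su2Quat a).im‖ ^ 2))) a := by
    filter_upwards [hae] with a ha
    have hs : 0 < ‖(su2Quat a).im‖ ^ 2 := by have := norm_pos_iff.2 ha; positivity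
    by_cases hle : ‖(su2Quat a).im‖ ^ 2 ≤ c
    · have hX : 1 ≤ t ^ 2 / (4 * ‖(su2Quat a).im‖ ^ 2) := by
        rw [le_div_iff₀ (by positivity)]; rw [hcdef] at hle; linarith
      rw [indicator_of_mem (show a ∈ {u : Matrix.specialUnitaryGroup (Fin 2) ℂ | ‖(su2Quat u).im‖ ^ 2 ≤ c} from hle),
        indicator_of_notMem (show a ∉ {a : Matrix.specialUnitaryGroup (Fin 2) ℂ | c < ‖(su2Quat a).im‖ ^ 2} from fun h => by
          simp only [Set.mem_setOf_eq] at h; linarith),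
        min_eq_left hX, Pi.one_apply, add_zero, ENNReal.ofReal_one]
    · push Not at hle
      have hX : t ^ 2 / (4 * ‖(su2Quat a).im‖ ^ 2) ≤ 1 := by
        rw [div_le_iff₀ (by positivity)]; rw [hcdef] at hle; linarith
      rw [indicator_of_notMem (show a ∉ {u : Matrix.specialUnitaryGroup (Fin 2) ℂ | ‖(su2Quat u).im‖ ^ 2 ≤ c} from fun h => by
          simp only [Set.mem_setOf_eq] at h; linarith),
        indicator_of_mem (show a ∈ {a : Matrix.specialUnitaryGroup (Fin 2) ℂ | c < ‖(su2Quat a).im‖ ^ 2} from hle),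
        min_eq_right hX, zero_add]
  have hTm : MeasurableSet {u : Matrix.specialUnitaryGroup (Fin 2) ℂ | ‖(su2Quat u).im‖ ^ 2 ≤ c} :=
    measurableSet_le continuous_sqNormIm.measurable measurable_const
  have hval1 : 0 ≤ Real.arctan (Real.sqrt (c / (1 - c))) - Real.sqrt (c / (1 - c)) * (1 + c / (1 - c))⁻¹ := by
    have hS : 0 ≤ c / (1 - c) := div_nonneg hc (by linarith)
    have h := integral_cap (Real.sqrt (c / (1 - c)))
    have hnn : 0 ≤ ∫ r in (0 : ℝ)..Real.sqrt (c / (1 - c)), r ^ 2 * ((1 + r ^ 2)⁻¹) ^ 2 :=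
      intervalIntegral.integral_nonneg (Real.sqrt_nonneg _) fun r _ => by positivity
    rw [h, Real.sq_sqrt hS] at hnn
    linarith
  have hval2 : 0 ≤ Real.pi / 2 - Real.arctan (Real.sqrt (c / (1 - c))) := by
    linarith [Real.arctan_lt_pi_div_two (Real.sqrt (c / (1 - c)))]
  rw [measureReal_def, haar_pair_commBall_eq_lintegral ht, lintegral_congr_ae hsplit, lintegral_add_left (measurable_one.indicator hTm),
    lintegral_indicator_one hTm, haar_sqNormIm_le_eq hc hc1, lintegral_haar_profile_offCap hc hc1 t,
    ← ENNReal.ofReal_add (by positivity) (by positivity), ENNReal.toReal_ofReal (by positivity)]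

/-! ## §23 The exact inverse moments (Bochner form) -/

/-- ★★ `∫ (‖Im q u‖²)⁻¹ dHaar(u) = 2` (Bochner integral; integrand `0` on the null set of central elements by the `0⁻¹ = 0` convention). [folklore] -/
theorem integral_haar_inv_sq_norm_im :
    ∫ u, (‖(su2Quat u).im‖ ^ 2)⁻¹ ∂(haarProbability (Matrix.specialUnitaryGroup (Fin 2) ℂ)) = 2 := by
  -- `t = 2` in ✓`lintegral_haar_profile`: `∫ 4/(4s²) = 2`
  have h := lintegral_haar_profile (2 : ℝ)
  have heq : ∀ u : Matrix.specialUnitaryGroup (Fin 2) ℂ, (2 : ℝ) ^ 2 / (4 * ‖(su2Quat u).im‖ ^ 2) = (‖(su2Quat u).im‖ ^ 2)⁻¹ := by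
    intro u
    by_cases hs : ‖(su2Quat u).im‖ ^ 2 = 0
    · rw [hs]; simp
    · field_simp; norm_num
  simp_rw [heq] at h
  norm_num at h
  have hm : AEStronglyMeasurable (fun u : Matrix.specialUnitaryGroup (Fin 2) ℂ => (‖(su2Quat u).im‖ ^ 2)⁻¹)
      (haarProbability (Matrix.specialUnitaryGroup (Fin 2) ℂ)) := (continuous_sqNormIm.measurable.inv).aestronglyMeasurable
  rw [integral_eq_lintegral_of_nonneg_ae (Filter.Eventually.of_forall fun u => by positivity) hm, h]
  norm_num

/-- ★★ `∫ (1 − re(q u)²)⁻¹ dHaar(u) = 2` — the form in fcl-p3 g43's memo (`v₂ = ¼·E[(1−re²)⁻¹] = ½`). [folklore] -/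
theorem integral_haar_inv_one_sub_re_sq :
    ∫ u, (1 - (su2Quat u).re ^ 2)⁻¹ ∂(haarProbability (Matrix.specialUnitaryGroup (Fin 2) ℂ)) = 2 := by
  have heq : ∀ u : Matrix.specialUnitaryGroup (Fin 2) ℂ, 1 - (su2Quat u).re ^ 2 = ‖(su2Quat u).im‖ ^ 2 := by
    intro u; rw [sq_norm_im_eq, norm_su2Quat, one_pow]
  simp_rw [heq]
  exact integral_haar_inv_sq_norm_im

end Summit.QuantumFields.YangMills.Theorems.SwapVirialDeficit.ZeroModeExact

end
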